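import Literature.NumberTheory.QuadraticFields.QuadraticIrrationalComposition
import Literature.Computability.Cryptography.InfrastructureNavigation
import Literature.Computability.Cryptography.FixedPointLogarithm
import Mathlib.Data.Nat.Size
import Mathlib.Analysis.Complex.ExponentialBounds
import HarnessLib

/-!
# The principal cycle of a real quadratic order as an abstract infrastructure with approximate
# distance evaluators (`GiantStepCycle` instance for Hallgren's walk)

Topic `Computability/Cryptography`; brick of the discharge of
`Literature.Computability.Cryptography.Hallgren2007_regulator_qsolvable[_delim]` (`HallgrenPell.lean`).
Joins the number theory of `Literature/NumberTheory/QuadraticFields/` (the continued-fraction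
infrastructure `QuadIrr`: principal cycle, Shanks distances `pos`, composition and the giant step
`giant_step_compose`) to the abstract walk of `InfrastructureNavigation.lean` (`WalkData`,
`GiantStepCycle`) and the fixed-point logarithms of `FixedPointLogarithm.lean`.
Theorem-and-definition file (no named facts). For a fundamental discriminant `D` (not a square):

* `cyc D : ℤ → QuadIrr D`, `upos D : ℤ → ℝ` — the principal cycle unrolled along `ℤ`
  (`cyc m = x_{(m mod p) + p}`, `upos m = pos (m mod p) + (m div p)·R`): `cyc 0 = x_p` is the
  reduced form of `𝒪` at distance `0`, `step (cyc m) = cyc (m+1)`, `cyc m = cyc m' ↔ p ∣ m − m'`,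
  `upos (m + p) = upos m + R`, `upos` strictly increasing, `upos (m+1) − upos m = log φ(step (cyc m))`
  (Jozsa 2003 §8: "the reduced principal ideals placed around a circle of circumference `R`");
* `exists_cyc_giant` — **the giant step in unrolled coordinates**: `reduce (compose (cyc m₁) (cyc m₂))
  = cyc m` with `upos m = upos m₁ + upos m₂ + log(|μ|·g)` EXACTLY (from `giant_step_compose`), the
  defect `kappa = log(|μ| g)` bounded by `Kq D = O(log² D)` (`abs_kappaR_le`; Jozsa Prop. 35 /
  Jacobson–Williams (7.28));
* the rational evaluators the program computes: `ghatQ` (`≈` the gap after an ideal, via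
  `logQIApprox`), `khatApprox`/`khatQ` (`≈ kappa`, summing `logQIApprox` over the Gauss-reduction
  factors, plus `logNatApprox g`), each within `etaR D prec = (Ks D + 2)·2^{−prec}` of the truth;
* **`principalGSC D prec`** : `GiantStepCycle (QuadIrr D)` — the instance (with `G = 1 + size D`,
  `L = log 2` from `log_two_lt_gap_add_gap_succ`, `η = etaR ≤ 1/8`), so that all of
  `InfrastructureNavigation.lean` (`final_correct`, `table_exact`, `table_blur`,
  `final_eq_of_generic_grid`) applies to the actual infrastructure of `ℚ(√D)`.

## References

* R. Jozsa, arXiv:quant-ph/0302134 (2003), §7 Props. 31–35, §8, §9 Thm. 5. [Jozsa2003]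
* M. J. Jacobson, Jr., H. C. Williams, *Solving the Pell Equation*, Springer (2009), §7.4 (7.28),
  §11.1–11.2. [JacobsonWilliams2008]
-/

noncomputable section

open scoped Classical
open Finset

namespace Literature.Computability.Cryptography

namespace Hallgren2007

open Literature.NumberTheory.QuadraticFields Literature.NumberTheory.QuadraticFields.QuadIrr
  Literature.Computability.Cryptography.FixedPointLog

variable {D : ℕ}

/-! ### Fundamental discriminants -/

/-- A fundamental discriminant is `≡ 0` or `1 (mod 4)`. [folklore] -/
theorem mod_four_of_isFundDiscr (hF : IsFundDiscr D) : D % 4 = 0 ∨ D % 4 = 1 := by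
  rcases hF with ⟨h1, -⟩ | ⟨h4, -, -⟩ <;> omega

/-- A non-square natural number is `≥ 2`. [folklore] -/
theorem two_le_of_not_isSquare (hD : ¬ IsSquare D) : 2 ≤ D := by
  by_contra h
  interval_cases D
  · exact hD ⟨0, rfl⟩
  · exact hD ⟨1, rfl⟩

/-! ### The unrolled principal cycle -/

/-- The `m`-th ideal of the unrolled principal cycle, `m ∈ ℤ`: `x_{(m mod p) + p}` (so that `m = 0`
gives `x_p`, the reduced form of `𝒪`). [cite: Jozsa2003, §8 (the principal cycle around a circle)] -/
def cyc (D : ℕ) (m : ℤ) : QuadIrr D :=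
  step^[(m % (periodLength D : ℕ)).toNat + periodLength D] (principalStart D)

/-- The unrolled distance of the `m`-th ideal: `pos (m mod p) + (m div p)·R`. [cite: Jozsa2003, §8] -/
def upos (D : ℕ) (m : ℤ) : ℝ :=
  pos D (m % (periodLength D : ℕ)).toNat + ((m / (periodLength D : ℕ) : ℤ) : ℝ) * Real.log (fundUnit D)

section Cycle

variable (hD : ¬ IsSquare D) (hD4 : D % 4 = 0 ∨ D % 4 = 1)
include hD hD4

/-- The residue index is `< p` and casts back to `m mod p`. [folklore] -/
theorem res_lt (m : ℤ) : (m % (periodLength D : ℕ)).toNat < periodLength D ∧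
    (((m % (periodLength D : ℕ)).toNat : ℕ) : ℤ) = m % (periodLength D : ℕ) := by
  have hp : (0 : ℤ) < (periodLength D : ℕ) := by exact_mod_cast periodLength_pos hD hD4
  have h0 : 0 ≤ m % (periodLength D : ℕ) := Int.emod_nonneg _ hp.ne'
  have h1 : m % (periodLength D : ℕ) < (periodLength D : ℕ) := Int.emod_lt_of_pos _ hp
  refine ⟨?_, Int.toNat_of_nonneg h0⟩
  have : ((m % (periodLength D : ℕ)).toNat : ℤ) < (periodLength D : ℕ) := by
    rw [Int.toNat_of_nonneg h0]; exact h1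
  exact_mod_cast this

omit hD hD4 in
/-- Periodicity of the principal expansion from index `1` on: `x_{k + lp} = x_k` (`k ≥ 1`). [cite: Jozsa2003, §6.3 Thm. 4(a)] -/
theorem iterate_add_mul_periodLength {k : ℕ} (hk : 1 ≤ k) (l : ℕ) :
    step^[k + l * periodLength D] (principalStart D) = step^[k] (principalStart D) := by
  obtain ⟨k, rfl⟩ : ∃ k', k = k' + 1 := ⟨k - 1, by omega⟩
  rw [show k + 1 + l * periodLength D = (k + l * periodLength D) + 1 by ring,
    iterate_succ_principalStart, iterate_succ_principalStart, Function.iterate_add_apply]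
  congr 1
  induction l with
  | zero => simp
  | succ l ih => rw [Nat.succ_mul, Function.iterate_add_apply, iterate_periodLength_principalFirst, ih]

/-- Division with remainder by `p`. [folklore] -/
theorem exists_eq_mul_add (m : ℤ) : ∃ (q : ℤ) (r : ℕ), r < periodLength D ∧ m = q * periodLength D + r := by
  obtain ⟨hr, hcast⟩ := res_lt hD hD4 m
  refine ⟨m / (periodLength D : ℕ), (m % (periodLength D : ℕ)).toNat, hr, ?_⟩
  have := Int.emod_def m (periodLength D : ℕ)
  rw [hcast]; linarith

/-- `cyc` and `upos` on `m = qp + r`, `0 ≤ r < p`. [folklore] -/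
theorem cyc_upos_of_eq {m q : ℤ} {r : ℕ} (hr : r < periodLength D) (h : m = q * periodLength D + r) :
    cyc D m = step^[r + periodLength D] (principalStart D) ∧
      upos D m = pos D r + (q : ℝ) * Real.log (fundUnit D) := by
  have hp : (0 : ℤ) < (periodLength D : ℕ) := by exact_mod_cast periodLength_pos hD hD4
  have hqr : m / (periodLength D : ℕ) = q ∧ m % (periodLength D : ℕ) = r := by
    rw [Int.ediv_emod_unique hp]
    refine ⟨by rw [h]; ring, by positivity, by exact_mod_cast hr⟩
  unfold cyc upos
  rw [hqr.1, hqr.2, Int.toNat_natCast]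
  exact ⟨rfl, rfl⟩

omit hD hD4 in
/-- `step (stepᵏ x₀) = stepᵏ⁺¹ x₀`. [folklore] -/
theorem step_iterate (k : ℕ) : step (step^[k] (principalStart D)) = step^[k + 1] (principalStart D) :=
  (Function.iterate_succ_apply' step k (principalStart D)).symm

/-- `cyc m` as an element of the expansion with index `≥ p ≥ 1`. [folklore] -/
theorem cyc_eq (m : ℤ) : ∃ r : ℕ, r < periodLength D ∧ (r : ℤ) = m % (periodLength D : ℕ) ∧
    cyc D m = step^[r + periodLength D] (principalStart D) :=
  ⟨_, (res_lt hD hD4 m).1, (res_lt hD hD4 m).2, rfl⟩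

/-- `cyc 0 = x_p`. [folklore] -/
theorem cyc_zero : cyc D 0 = step^[periodLength D] (principalStart D) := by
  have h := (cyc_upos_of_eq hD hD4 (m := 0) (q := 0) (r := 0) (periodLength_pos hD hD4) (by simp)).1
  simpa using h

/-- `upos 0 = 0`. [folklore] -/
theorem upos_zero : upos D 0 = 0 := by
  have h := (cyc_upos_of_eq hD hD4 (m := 0) (q := 0) (r := 0) (periodLength_pos hD hD4) (by simp)).2
  rw [h, pos]; simp

omit hD hD4 in
/-- `cyc (m + p) = cyc m`. [folklore] -/
theorem cyc_add_periodLength (m : ℤ) : cyc D (m + periodLength D) = cyc D m := by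
  unfold cyc; rw [Int.add_emod_right]

omit hD hD4 in
/-- `cyc (m + k p) = cyc m`. [folklore] -/
theorem cyc_add_mul_periodLength (m k : ℤ) : cyc D (m + k * periodLength D) = cyc D m := by
  unfold cyc; rw [Int.add_mul_emod_self_right]

/-- **One period further is `R` further**: `upos (m + p) = upos m + R`. [cite: Jozsa2003, §8] -/
theorem upos_add_periodLength (m : ℤ) : upos D (m + periodLength D) = upos D m + Real.log (fundUnit D) := by
  obtain ⟨q, r, hr, hm⟩ := exists_eq_mul_add hD hD4 m
  have h1 := (cyc_upos_of_eq hD hD4 hr hm).2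
  have h2 := (cyc_upos_of_eq hD hD4 (m := m + periodLength D) (q := q + 1) hr (by rw [hm]; ring)).2
  rw [h1, h2]; push_cast; ring

/-- **The baby step moves one ideal further**: `step (cyc m) = cyc (m + 1)`. [cite: Jozsa2003, §6.3 Thm. 4(a)] -/
theorem step_cyc (m : ℤ) : step (cyc D m) = cyc D (m + 1) := by
  have hp := periodLength_pos hD hD4
  obtain ⟨q, r, hr, hm⟩ := exists_eq_mul_add hD hD4 m
  rw [(cyc_upos_of_eq hD hD4 hr hm).1, step_iterate]
  rcases Nat.lt_or_ge (r + 1) (periodLength D) with h | h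
  · rw [(cyc_upos_of_eq hD hD4 (m := m + 1) (q := q) h (by rw [hm]; push_cast; ring)).1,
      show r + periodLength D + 1 = r + 1 + periodLength D by ring]
  · have hr1 : r + 1 = periodLength D := by omega
    rw [(cyc_upos_of_eq hD hD4 (m := m + 1) (q := q + 1) (r := 0) hp (by rw [hm, ← hr1]; push_cast; ring)).1,
      zero_add, show r + periodLength D + 1 = periodLength D + 1 * periodLength D by rw [← hr1]; ring]
    exact iterate_add_mul_periodLength hp 1

/-- The gap after `cyc m`: **`upos (m+1) − upos m = log φ(step (cyc m))`**. [cite: Jozsa2003, §7 Prop. 31 (δ(J, ρJ) = ln γ)] -/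
theorem upos_succ (m : ℤ) : upos D (m + 1) = upos D m + Real.log ((step (cyc D m)).val) := by
  have hp := periodLength_pos hD hD4
  obtain ⟨q, r, hr, hm⟩ := exists_eq_mul_add hD hD4 m
  obtain ⟨hc, hu⟩ := cyc_upos_of_eq hD hD4 hr hm
  rw [hu, hc, step_iterate]
  rcases Nat.lt_or_ge (r + 1) (periodLength D) with h | h
  · rw [(cyc_upos_of_eq hD hD4 (m := m + 1) (q := q) h (by rw [hm]; push_cast; ring)).2, pos_succ, gap,
      ← iterate_succ_principalStart,
      show r + periodLength D + 1 = (r + 1) + 1 * periodLength D by ring, iterate_add_mul_periodLength (by omega) 1]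
    ring
  · have hr1 : r + 1 = periodLength D := by omega
    rw [(cyc_upos_of_eq hD hD4 (m := m + 1) (q := q + 1) (r := 0) hp (by rw [hm, ← hr1]; push_cast; ring)).2,
      show r + periodLength D + 1 = periodLength D + 1 * periodLength D by rw [← hr1]; ring,
      iterate_add_mul_periodLength hp 1, pos, Finset.sum_range_zero, zero_add,
      ← pos_periodLength hD hD4, ← hr1, pos_succ, gap, ← iterate_succ_principalStart]
    push_cast; ring

/-- `cyc m` is a reduced element of the principal cycle. [cite: Jozsa2003, §6.3 Thm. 4(a)] -/
theorem isReduced_cyc (m : ℤ) : (cyc D m).IsReduced := by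
  obtain ⟨r, -, -, hc⟩ := cyc_eq hD hD4 m
  obtain ⟨k, hk⟩ : ∃ k, r + periodLength D = k + 1 := ⟨r + periodLength D - 1, by have := periodLength_pos hD hD4; omega⟩
  rw [hc, hk]
  exact (isPreReduced_principalStart hD hD4).isReduced_iterate_succ hD k

/-- **Labels name ideals**: `cyc m = cyc m' ↔ p ∣ m − m'`. [cite: Jozsa2003, §6.3 Thm. 4(a) (the cycle consists of distinct ideals)] -/
theorem cyc_eq_cyc_iff (m m' : ℤ) : cyc D m = cyc D m' ↔ (periodLength D : ℤ) ∣ m - m' := by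
  have hp := periodLength_pos hD hD4
  obtain ⟨q, r, hr, hm⟩ := exists_eq_mul_add hD hD4 m
  obtain ⟨q', r', hr', hm'⟩ := exists_eq_mul_add hD hD4 m'
  rw [(cyc_upos_of_eq hD hD4 hr hm).1, (cyc_upos_of_eq hD hD4 hr' hm').1]
  obtain ⟨k, hk⟩ : ∃ k, r + periodLength D = k + 1 := ⟨r + periodLength D - 1, by omega⟩
  obtain ⟨k', hk'⟩ : ∃ k', r' + periodLength D = k' + 1 := ⟨r' + periodLength D - 1, by omega⟩
  rw [hk, hk', iterate_succ_principalStart, iterate_succ_principalStart,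
    iterate_eq_iterate_iff_modEq hD (isReduced_principalFirst hD hD4)]
  change k ≡ k' [MOD periodLength D] ↔ _
  constructor
  · intro hmod
    have : r = r' := by
      have h1 : k % periodLength D = k' % periodLength D := hmod
      have h2 : (k + 1) % periodLength D = (k' + 1) % periodLength D := by
        rw [Nat.add_mod, h1, ← Nat.add_mod]
      rw [← hk, ← hk', Nat.add_mod_right, Nat.add_mod_right, Nat.mod_eq_of_lt hr, Nat.mod_eq_of_lt hr'] at h2
      exact h2
    subst this
    exact ⟨q - q', by rw [hm, hm']; ring⟩
  · rintro ⟨c, hc⟩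
    have : r = r' := by
      have e : (r : ℤ) - r' = (c - q + q') * periodLength D := by linarith
      have habs : |(r : ℤ) - r'| < periodLength D := by
        rw [abs_lt]; constructor <;> omega
      rw [e, abs_mul, Nat.abs_cast] at habs
      have : |c - q + q'| < 1 := by
        by_contra hge
        push Not at hge
        have : (periodLength D : ℤ) * 1 ≤ |c - q + q'| * periodLength D := by nlinarith
        linarith
      have h0 : c - q + q' = 0 := Int.abs_lt_one_iff.mp this
      have : (r : ℤ) = r' := by rw [h0] at e; linarith
      exact_mod_cast this
    subst this
    have : k = k' := by omega
    rw [this]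

/-- **Distances increase.** [cite: Jozsa2003, §8] -/
theorem upos_strictMono : StrictMono (upos D) := by
  have hp := periodLength_pos hD hD4
  have hR : 0 < Real.log (fundUnit D) := Real.log_pos (one_lt_fundUnit hD hD4)
  intro m m' hlt
  obtain ⟨q, r, hr, hm⟩ := exists_eq_mul_add hD hD4 m
  obtain ⟨q', r', hr', hm'⟩ := exists_eq_mul_add hD hD4 m'
  rw [(cyc_upos_of_eq hD hD4 hr hm).2, (cyc_upos_of_eq hD hD4 hr' hm').2]
  have hmono := pos_strictMono hD hD4
  rcases lt_trichotomy q q' with h | h | h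
  · have h1 : pos D r < Real.log (fundUnit D) := by rw [← pos_periodLength hD hD4]; exact hmono hr
    have h2 : (0 : ℝ) ≤ pos D r' := pos_nonneg hD hD4 r'
    have h3 : ((q : ℝ) + 1) ≤ q' := by exact_mod_cast h
    nlinarith
  · subst h
    have : r < r' := by
      have : (r : ℤ) < r' := by linarith
      exact_mod_cast this
    have := hmono this
    linarith
  · exfalso
    have : (q' + 1) * (periodLength D : ℤ) ≤ q * periodLength D := by
      have h3 : q' + 1 ≤ q := h
      exact mul_le_mul_of_nonneg_right h3 (by positivity)
    have : (r' : ℤ) < periodLength D := by exact_mod_cast hr'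
    nlinarith

/-- `upos` in terms of `valProd`: `pos n = log Π_n`. [cite: JacobsonWilliams2008, §7.4 (δ_n = log θ_n)] -/
theorem pos_eq_log_valProd (n : ℕ) : pos D n = Real.log (valProd (principalStart D) n) := by
  unfold pos valProd
  rw [Real.log_prod]
  · refine Finset.sum_congr rfl fun j _ => ?_
    rw [gap, ← iterate_succ_principalStart]
  · intro k _
    exact (ne_of_gt (by linarith [((isPreReduced_principalStart hD hD4).isReduced_iterate_succ hD k).2.2.1]))

end Cycle


/-! ### The giant step in unrolled coordinates -/

/-- The distance defect of the giant step: `κ(a, b) = log(|μ| · g)`, `μ` the Gauss-reduction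
multiplier of `compose a b` and `g = gcd(a₁, a₂, s)`. [cite: Jozsa2003, §7.1 Prop. 35] -/
def kappaR (D : ℕ) (a b : QuadIrr D) : ℝ := Real.log (|reduceMult (compose a b)| * compG a b)

section Giant

variable (hD : ¬ IsSquare D) (hF : IsFundDiscr D)
include hD hF

/-- **The giant step lands on the cycle at the sum of the distances plus the defect, exactly**:
`reduce (compose (cyc m₁) (cyc m₂)) = cyc m` with `upos m = upos m₁ + upos m₂ + κ`.
[cite: Jozsa2003, §7.1 Prop. 35] -/
theorem exists_cyc_giant (m₁ m₂ : ℤ) : ∃ m : ℤ, cyc D m = reduce (compose (cyc D m₁) (cyc D m₂)) ∧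
    upos D m = upos D m₁ + upos D m₂ + kappaR D (cyc D m₁) (cyc D m₂) := by
  have hD4 := mod_four_of_isFundDiscr hF
  have hp := periodLength_pos hD hD4
  have h0 := isPreReduced_principalStart hD hD4
  set R := Real.log (fundUnit D) with hR
  obtain ⟨q₁, r₁, hr₁, hm₁⟩ := exists_eq_mul_add hD hD4 m₁
  obtain ⟨q₂, r₂, hr₂, hm₂⟩ := exists_eq_mul_add hD hD4 m₂
  obtain ⟨hc₁, hu₁⟩ := cyc_upos_of_eq hD hD4 hr₁ hm₁
  obtain ⟨hc₂, hu₂⟩ := cyc_upos_of_eq hD hD4 hr₂ hm₂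
  obtain ⟨m', hm'1, hm'p, hw, j, hj⟩ := giant_step_compose hD hD4 hF (r₁ + periodLength D) (r₂ + periodLength D)
  rw [hc₁, hc₂, hu₁, hu₂, hw]
  -- logarithms of the product identity
  have hμ0 : reduceMult (compose (step^[r₁ + periodLength D] (principalStart D))
      (step^[r₂ + periodLength D] (principalStart D))) ≠ 0 := by
    intro h; rw [h] at hj
    have := valProd_pos hD h0 m'
    have := one_lt_fundUnit hD hD4
    have : (0 : ℝ) < valProd (principalStart D) m' * fundUnit D ^ j := by positivity
    simp only [abs_zero, zero_mul] at hj; linarith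
  have hg : 0 < compG (step^[r₁ + periodLength D] (principalStart D)) (step^[r₂ + periodLength D] (principalStart D)) :=
    compG_pos (isIdealShaped_iterate hD hD4 _)
  have hgR : (0 : ℝ) < compG (step^[r₁ + periodLength D] (principalStart D)) (step^[r₂ + periodLength D] (principalStart D)) := by
    exact_mod_cast hg
  have hP1 := valProd_pos hD h0 (r₁ + periodLength D)
  have hP2 := valProd_pos hD h0 (r₂ + periodLength D)
  have hPm := valProd_pos hD h0 m'
  have hε := one_lt_fundUnit hD hD4
  have hlog := congrArg Real.log hj
  rw [Real.log_mul (by positivity) hP2.ne', Real.log_mul (by positivity) hP1.ne',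
    Real.log_mul hPm.ne' (by positivity), Real.log_zpow, ← pos_eq_log_valProd hD hD4,
    ← pos_eq_log_valProd hD hD4, ← pos_eq_log_valProd hD hD4, pos_add_periodLength hD hD4,
    pos_add_periodLength hD hD4] at hlog
  -- `hlog : κ + (pos r₁ + R) + (pos r₂ + R) = pos m' + j R`
  unfold kappaR
  rcases Nat.lt_or_ge m' (periodLength D) with hlt | hge
  · obtain ⟨hc, hu⟩ := cyc_upos_of_eq hD hD4 (m := (j + q₁ + q₂ - 2) * periodLength D + m') (q := j + q₁ + q₂ - 2) hlt rfl
    refine ⟨(j + q₁ + q₂ - 2) * periodLength D + m', ?_, ?_⟩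
    · rw [hc, show m' + periodLength D = m' + 1 * periodLength D by ring, iterate_add_mul_periodLength hm'1 1]
    · rw [hu]; push_cast; linarith
  · have hm'e : m' = periodLength D := le_antisymm hm'p hge
    rw [hm'e, pos_periodLength hD hD4] at hlog
    obtain ⟨hc, hu⟩ := cyc_upos_of_eq hD hD4 (m := (j + q₁ + q₂ - 1) * periodLength D + 0) (q := j + q₁ + q₂ - 1) (r := 0) hp rfl
    refine ⟨(j + q₁ + q₂ - 1) * periodLength D + 0, ?_, ?_⟩
    · rw [hc, zero_add, hm'e]
    · rw [hu, pos, Finset.sum_range_zero]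
      push_cast; linarith

/-! ### Bounds for the defect -/

/-- The step-count bound `Ks = ⌊log₄ (2D)⌋ + 3`. [cite: Jozsa2003, §6.2 Prop. 21] -/
def Ks (D : ℕ) : ℕ := Nat.log 4 (2 * D) + 3

/-- The rational defect bound `Kq = Ks·(2·size D + 3) + size D`. [cite: Jozsa2003, §7.1 Prop. 35 (bounded correction)] -/
def Kq (D : ℕ) : ℚ := ((Ks D * (2 * Nat.size D + 3) + Nat.size D : ℕ) : ℚ)

omit hD hF in
/-- `Q(compose a b) ≤ 2D` for reduced ideal-shaped `a, b` (`Aᵢ ≤ aᵢ ≤ ⌊√D⌋`). [folklore] -/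
theorem compose_Q_le {a b : QuadIrr D} (ha : a.IsReduced) (hb : b.IsReduced) (hsa : a.IsIdealShaped)
    (hsb : b.IsIdealShaped) (d : CompData a b) : (compose a b).Q ≤ 2 * D ∧ 0 < (compose a b).Q := by
  obtain ⟨-, hQ⟩ := d.compose_P_Q hsa
  have hA₁ := d.A₁_pos hsa
  have hA₂ := d.A₂_pos hsa hsb
  have hg := compG_pos (y := b) hsa
  obtain ⟨-, -, -, haQ⟩ := ha.bounds
  obtain ⟨-, -, -, hbQ⟩ := hb.bounds
  have hfa : fa a ≤ Nat.sqrt D := by unfold fa; omega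
  have hfb : fa b ≤ Nat.sqrt D := by unfold fa; omega
  have h1 : d.A₁ ≤ fa a := by rw [d.ha₁]; nlinarith
  have h2 : d.A₂ ≤ fa b := by rw [d.ha₂]; nlinarith
  have hs : (Nat.sqrt D : ℤ) * Nat.sqrt D ≤ D := by exact_mod_cast Nat.sqrt_le D
  refine ⟨?_, by rw [hQ]; positivity⟩
  rw [hQ]; nlinarith

omit hD hF in
/-- `gaussSteps (compose a b) ≤ Ks D` on the cycle. [cite: Jozsa2003, §6.2 Prop. 21] -/
theorem gaussSteps_le {z : QuadIrr D} (hz : z.Q ≤ 2 * D) : gaussSteps z ≤ Ks D := by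
  unfold gaussSteps Ks
  have : z.Q.toNat ≤ 2 * D := by omega
  have := Nat.log_mono_right (b := 4) this
  omega

omit hD hF in
/-- `log 2 ≤ 1` and `log D ≤ size D`. [folklore] -/
theorem log_le_size (n : ℕ) : Real.log n ≤ Nat.size n := by
  rcases Nat.eq_zero_or_pos n with rfl | hn
  · simp
  · have h : (n : ℝ) < 2 ^ Nat.size n := by exact_mod_cast Nat.lt_size_self n
    have := Real.log_lt_log (by exact_mod_cast hn) h
    rw [Real.log_pow] at this
    have h2 : Real.log 2 ≤ 1 := by have := Real.log_two_lt_d9; linarith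
    have h3 : (Nat.size n : ℝ) * Real.log 2 ≤ Nat.size n := by nlinarith [Real.log_pos one_lt_two]
    linarith

/-- **The defect is bounded**: `|κ(cyc m₁, cyc m₂)| ≤ Kq D`. [cite: Jozsa2003, §7.1 Prop. 35] -/
theorem abs_kappaR_le (m₁ m₂ : ℤ) : |kappaR D (cyc D m₁) (cyc D m₂)| ≤ Kq D := by
  have hD4 := mod_four_of_isFundDiscr hF
  have hD2 := two_le_of_not_isSquare hD
  set a := cyc D m₁
  set b := cyc D m₂
  have ha : a.IsReduced := isReduced_cyc hD hD4 m₁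
  have hb : b.IsReduced := isReduced_cyc hD hD4 m₂
  obtain ⟨r₁, -, -, hc₁⟩ := cyc_eq hD hD4 m₁
  obtain ⟨r₂, -, -, hc₂⟩ := cyc_eq hD hD4 m₂
  have hsa : a.IsIdealShaped := by rw [show a = cyc D m₁ from rfl, hc₁]; exact isIdealShaped_iterate hD hD4 _
  have hsb : b.IsIdealShaped := by rw [show b = cyc D m₂ from rfl, hc₂]; exact isIdealShaped_iterate hD hD4 _
  obtain ⟨d⟩ := exists_compData hsa hsb (isPrimitive_of_isFundDiscr hF hsa)
  obtain ⟨hzQ, hzQ0⟩ := compose_Q_le ha hb hsa hsb d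
  set z := compose a b with hz
  have hadm : z.IsAdmissible := (isIdealShaped_compose hsa hsb d).isAdmissible
  have hK := gaussSteps_le hzQ
  have hlow := le_abs_reduceMult hD hadm hzQ0
  have hupp := abs_reduceMult_le hD hadm hzQ0
  have hg := compG_pos (y := b) hsa
  -- sizes
  have hDR : (2 : ℝ) ≤ D := by exact_mod_cast hD2
  have hsqrtD : Real.sqrt D ≤ D := by
    rw [Real.sqrt_le_left (by positivity)]; nlinarith
  have hzQR : (z.Q : ℝ) ≤ 2 * D := by exact_mod_cast hzQ
  have hM : max (z.Q : ℝ) (Real.sqrt D) ≤ 2 * D := max_le hzQR (by linarith)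
  have hM0 : 0 ≤ max (z.Q : ℝ) (Real.sqrt D) := le_max_of_le_right (Real.sqrt_nonneg _)
  have hbase : max 1 (max (z.Q : ℝ) (Real.sqrt D) * (Real.sqrt D + max (z.Q : ℝ) (Real.sqrt D))) ≤ 6 * (D : ℝ) ^ 2 := by
    refine max_le (by nlinarith) ?_
    calc max (z.Q : ℝ) (Real.sqrt D) * (Real.sqrt D + max (z.Q : ℝ) (Real.sqrt D))
        ≤ (2 * D) * (D + 2 * D) := mul_le_mul hM (by linarith) (by positivity) (by positivity)
      _ = 6 * (D : ℝ) ^ 2 := by ring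
  have hlogD : Real.log D ≤ Nat.size D := log_le_size D
  have hlog2 : Real.log 2 ≤ 1 := by have := Real.log_two_lt_d9; linarith
  have hlog6 : Real.log (6 * (D : ℝ) ^ 2) ≤ 2 * Nat.size D + 3 := by
    rw [Real.log_mul (by norm_num) (by positivity), Real.log_pow]
    have : Real.log 6 ≤ 3 := by
      have h8 : Real.log 6 ≤ Real.log 8 := Real.log_le_log (by norm_num) (by norm_num)
      rw [show (8 : ℝ) = 2 ^ 3 by norm_num, Real.log_pow] at h8
      push_cast at h8; linarith
    push_cast; linarith
  -- upper bound on `log |μ|`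
  have hμpos : 0 < |reduceMult z| := lt_of_lt_of_le (by positivity) hlow
  have hup : Real.log |reduceMult z| ≤ Ks D * (2 * Nat.size D + 3) := by
    have h1 : Real.log |reduceMult z| ≤ gaussSteps z * Real.log (6 * (D : ℝ) ^ 2) := by
      rw [← Real.log_pow]
      apply Real.log_le_log hμpos
      refine hupp.trans ?_
      exact pow_le_pow_left₀ (le_trans zero_le_one (le_max_left _ _)) hbase _
    have h2 : (gaussSteps z : ℝ) * Real.log (6 * (D : ℝ) ^ 2) ≤ Ks D * (2 * Nat.size D + 3) := by
      apply mul_le_mul (by exact_mod_cast hK) hlog6 ?_ (by positivity)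
      exact Real.log_nonneg (by nlinarith)
    linarith
  -- lower bound on `log |μ|`
  have hlo : -(Ks D : ℝ) ≤ Real.log |reduceMult z| := by
    have h1 : Real.log ((1 / 2 : ℝ) ^ gaussSteps z) ≤ Real.log |reduceMult z| :=
      Real.log_le_log (by positivity) hlow
    rw [Real.log_pow, one_div, Real.log_inv] at h1
    have h2 : (gaussSteps z : ℝ) * Real.log 2 ≤ Ks D := by
      calc (gaussSteps z : ℝ) * Real.log 2 ≤ gaussSteps z * 1 :=
            mul_le_mul_of_nonneg_left hlog2 (by positivity)
        _ ≤ Ks D := by rw [mul_one]; exact_mod_cast hK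
    linarith
  -- `0 ≤ log g ≤ size D`
  have hg1 : (1 : ℝ) ≤ compG a b := by exact_mod_cast hg
  have hgle : (compG a b : ℝ) ≤ D := by
    obtain ⟨-, -, -, haQ⟩ := ha.bounds
    have hfa : fa a ≤ Nat.sqrt D := by unfold fa; omega
    have h1 : compG a b ≤ fa a := by
      have := d.ha₁; have := d.A₁_pos hsa; nlinarith
    have h2 : (Nat.sqrt D : ℤ) ≤ D := by exact_mod_cast Nat.sqrt_le_self D
    have : compG a b ≤ (D : ℤ) := by linarith
    exact_mod_cast this
  have hlogg0 : 0 ≤ Real.log (compG a b) := Real.log_nonneg hg1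
  have hlogg : Real.log (compG a b) ≤ Nat.size D :=
    (Real.log_le_log (by linarith) hgle).trans hlogD
  -- assemble
  unfold kappaR
  rw [← hz, Real.log_mul hμpos.ne' (by positivity)]
  unfold Kq; push_cast
  rw [abs_le]
  constructor <;> nlinarith [Nat.cast_nonneg (α := ℝ) (Nat.size D), Nat.cast_nonneg (α := ℝ) (Ks D)]

end Giant

/-! ### Guarded (self-limiting) operations: what the program actually iterates

The program cannot test membership in the cycle; it guards the baby and giant steps by the integer
bounds `1 ≤ P ≤ ⌊√D⌋`, `1 ≤ Q ≤ 2⌊√D⌋ + 1` of reduced quotients (`IsReduced.bounds`), freezing any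
state outside them. On the cycle the guards pass, so the walk is unchanged; off the cycle (and for
inputs `D` that are not discriminants) the guards keep every intermediate integer polynomially
bounded, which the `FP` implementation needs on ALL inputs. -/

/-- The integer bounds of a reduced quotient, as a test. [cite: JacobsonWilliams2008, §3.3 (3.32)] -/
def inBounds (D : ℕ) (a : QuadIrr D) : Prop :=
  1 ≤ a.P ∧ a.P ≤ Nat.sqrt D ∧ 1 ≤ a.Q ∧ a.Q ≤ 2 * Nat.sqrt D + 1

/-- The guard is decidable (integer comparisons). [folklore] -/
instance (D : ℕ) (a : QuadIrr D) : Decidable (inBounds D a) := by unfold inBounds; infer_instance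

/-- Reduced quotients pass the guard. [cite: JacobsonWilliams2008, §3.3 (3.32)] -/
theorem inBounds_of_isReduced {a : QuadIrr D} (h : a.IsReduced) : inBounds D a := h.bounds

/-- **The guarded baby step**: the step, taken only when input AND output pass the bounds test
(so that every state the program ever holds is within the bounds or is an earlier state). [folklore] -/
def stepG (D : ℕ) (a : QuadIrr D) : QuadIrr D := if inBounds D a ∧ inBounds D (step a) then step a else a

/-- **The guarded giant step** `reduce ∘ compose`, taken only when inputs and output pass the bounds
test (first argument returned otherwise). [folklore] -/
def starG (D : ℕ) (a b : QuadIrr D) : QuadIrr D :=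
  if inBounds D a ∧ inBounds D b ∧ inBounds D (reduce (compose a b)) then reduce (compose a b) else a

/-- On reduced input with reduced step the guarded baby step is the baby step. [folklore] -/
theorem stepG_of_isReduced {a : QuadIrr D} (h : a.IsReduced) (h' : (step a).IsReduced) : stepG D a = step a := by
  simp [stepG, inBounds_of_isReduced h, inBounds_of_isReduced h']

/-- On reduced inputs with reduced result the guarded giant step is `reduce ∘ compose`. [folklore] -/
theorem starG_of_isReduced {a b : QuadIrr D} (ha : a.IsReduced) (hb : b.IsReduced)
    (hr : (reduce (compose a b)).IsReduced) : starG D a b = reduce (compose a b) := by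
  simp [starG, inBounds_of_isReduced ha, inBounds_of_isReduced hb, inBounds_of_isReduced hr]

/-- Every value of the guarded steps is within the bounds or is the (first) argument. [folklore] -/
theorem stepG_inBounds_or (D : ℕ) (a : QuadIrr D) : inBounds D (stepG D a) ∨ stepG D a = a := by
  unfold stepG; split_ifs with h
  · exact Or.inl h.2
  · exact Or.inr rfl

/-- Every value of the guarded giant step is within the bounds or is the first argument. [folklore] -/
theorem starG_inBounds_or (D : ℕ) (a b : QuadIrr D) : inBounds D (starG D a b) ∨ starG D a b = a := by
  unfold starG; split_ifs with h
  · exact Or.inl h.2.2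
  · exact Or.inr rfl

/-- Clamping a rational to `[−K, K]`. [folklore] -/
def clampQ (K q : ℚ) : ℚ := max (-K) (min K q)

/-- `|clampQ K q| ≤ K` for `K ≥ 0`. [folklore] -/
theorem abs_clampQ_le {K : ℚ} (hK : 0 ≤ K) (q : ℚ) : |clampQ K q| ≤ K := by
  unfold clampQ
  rw [abs_le]
  constructor
  · exact le_max_left _ _
  · exact max_le (by linarith) (min_le_left _ _)

/-- Clamping to an interval containing `κ` does not increase the distance to `κ`. [folklore] -/
theorem abs_clampQ_sub_le {K q : ℚ} {κ : ℝ} (hκ : |κ| ≤ K) : |(clampQ K q : ℝ) - κ| ≤ |(q : ℝ) - κ| := by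
  rw [abs_le] at hκ
  unfold clampQ
  push_cast
  rcases le_total (q : ℝ) K with h1 | h1
  · rw [min_eq_right h1]
    rcases le_total (-(K : ℝ)) q with h2 | h2
    · rw [max_eq_right h2]
    · rw [max_eq_left h2, abs_le]
      have := abs_nonneg ((q : ℝ) - κ)
      rw [abs_of_nonpos (by linarith)] 
      constructor <;> linarith
  · rw [min_eq_left h1, max_eq_right (by linarith), abs_le]
    rw [abs_of_nonneg (by linarith : (0 : ℝ) ≤ (q : ℝ) - κ)]
    constructor <;> linarith

/-! ### The evaluators -/

/-- **The computed gap after `a`**: `ĝ(a) =` the dyadic rounding of `logQIApprox` of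
`φ(step a) = (P' + √D)/Q'`. [cite: Jozsa2003, §9 (proof of Thm. 5: accumulating distances to sufficient accuracy)] -/
def ghatQ (D prec : ℕ) (a : QuadIrr D) : ℚ := dyRound prec (logQIApprox D (stepG D a).P (stepG D a).Q prec)

/-- The computed logarithm of one Gauss-reduction factor. [cite: JacobsonWilliams2008, §11.2] -/
def logFactorApprox (D prec : ℕ) (y : QuadIrr D) : ℚ :=
  if y.Q ^ 2 < D then 0 else logQIApprox D (gaussRaw y).P (gaussRaw y).Q prec

/-- **The computed defect** `k̂(a, b) =` the dyadic rounding of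
`∑ᵢ (log of the i-th reduction factor)^ + (log g)^`. [cite: JacobsonWilliams2008, §11.2] -/
def khatApprox (D prec : ℕ) (a b : QuadIrr D) : ℚ :=
  dyRound prec ((∑ i ∈ range (gaussSteps (compose a b)), logFactorApprox D prec (gaussStep^[i] (compose a b))) +
    logNatApprox (compG a b).toNat prec)

/-- Cycle elements. [folklore] -/
def IsCyc (D : ℕ) (a : QuadIrr D) : Prop := ∃ m : ℤ, a = cyc D m

/-- **The computed defect as the program evaluates it**: guarded by the bounds and clamped to
`[−Kq, Kq]` (total, computable from `(D, prec, a, b)`). [folklore] -/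
def khatQ (D prec : ℕ) (a b : QuadIrr D) : ℚ :=
  clampQ (Kq D) (if inBounds D a ∧ inBounds D b then khatApprox D prec a b else 0)

/-- The defect as a total function: the true defect `κ` on the cycle, and (harmlessly) the computed
value off the cycle, where nothing is claimed. [folklore] -/
def kappa' (D prec : ℕ) (a b : QuadIrr D) : ℝ :=
  if IsCyc D a ∧ IsCyc D b then kappaR D a b else (khatQ D prec a b : ℝ)

/-- The precision of the evaluators: `η = (Ks + 3)·2^{−prec}`. [folklore] -/
def etaR (D prec : ℕ) : ℝ := ((Ks D + 3 : ℕ) : ℝ) * (1 / 2) ^ prec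

/-- `|Π-structure of the multiplier|`: `|gaussMult n x| = ∏_{i<n} |gaussFactor (gaussStepⁱ x)|`. [folklore] -/
theorem abs_gaussMult_eq_prod : ∀ (n : ℕ) (x : QuadIrr D),
    |gaussMult n x| = ∏ i ∈ range n, |gaussFactor (gaussStep^[i] x)|
  | 0, x => by simp [gaussMult]
  | n + 1, x => by
    rw [gaussMult, abs_mul, abs_gaussMult_eq_prod n (gaussStep x), Finset.prod_range_succ']
    simp only [Function.iterate_succ_apply, Function.iterate_zero, id_eq]

section Eval

variable (hD : ¬ IsSquare D) (hF : IsFundDiscr D)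
include hD hF

/-- **Accuracy of the gap evaluator**: `|ĝ(cyc m) − (upos (m+1) − upos m)| ≤ 2·2^{−prec}`. [cite: Jozsa2003, §9 Thm. 5] -/
theorem abs_ghatQ_sub_le (prec : ℕ) (m : ℤ) :
    |(ghatQ D prec (cyc D m) : ℝ) - (upos D (m + 1) - upos D m)| ≤ 2 * (1 / 2) ^ prec := by
  have hD4 := mod_four_of_isFundDiscr hF
  have hD1 : 1 ≤ D := by have := two_le_of_not_isSquare hD; omega
  rw [upos_succ hD hD4 m, add_sub_cancel_left, step_cyc hD hD4]
  have hred := isReduced_cyc hD hD4 (m + 1)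
  have hQ : (cyc D (m + 1)).Q ≠ 0 := ne_of_gt hred.1
  have hv : 0 < (cyc D (m + 1)).val := by linarith [hred.2.2.1]
  have h := abs_logQIApprox_sub_log_le hD hD1 (cyc D (m + 1)).P hQ prec
  unfold ghatQ
  rw [stepG_of_isReduced (isReduced_cyc hD hD4 m) (by rw [step_cyc hD hD4]; exact isReduced_cyc hD hD4 (m + 1)),
    step_cyc hD hD4]
  have hval : |(((cyc D (m + 1)).P : ℝ) + Real.sqrt D) / (cyc D (m + 1)).Q| = (cyc D (m + 1)).val := by
    rw [abs_of_pos]; · rfl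
    exact hv
  rw [hval] at h
  have hr := abs_dyRound_sub_le prec (logQIApprox D (cyc D (m + 1)).P (cyc D (m + 1)).Q prec)
  calc |(dyRound prec (logQIApprox D (cyc D (m + 1)).P (cyc D (m + 1)).Q prec) : ℝ) - Real.log (cyc D (m + 1)).val|
      ≤ |(dyRound prec (logQIApprox D (cyc D (m + 1)).P (cyc D (m + 1)).Q prec) : ℝ) -
          (logQIApprox D (cyc D (m + 1)).P (cyc D (m + 1)).Q prec : ℝ)| +
        |(logQIApprox D (cyc D (m + 1)).P (cyc D (m + 1)).Q prec : ℝ) - Real.log (cyc D (m + 1)).val| :=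
        abs_sub_le _ _ _
    _ ≤ (1 / 2) ^ prec + (1 / 2) ^ prec := add_le_add hr h
    _ = 2 * (1 / 2) ^ prec := by ring

/-- **Accuracy of the defect evaluator** on the cycle:
`|k̂(cyc m₁, cyc m₂) − κ(cyc m₁, cyc m₂)| ≤ (Ks + 1)·2^{−prec}`. [cite: Jozsa2003, §9 Thm. 5] -/
theorem abs_khatApprox_sub_kappaR_le (prec : ℕ) (m₁ m₂ : ℤ) :
    |(khatApprox D prec (cyc D m₁) (cyc D m₂) : ℝ) - kappaR D (cyc D m₁) (cyc D m₂)| ≤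
      ((Ks D + 2 : ℕ) : ℝ) * (1 / 2) ^ prec := by
  have hD4 := mod_four_of_isFundDiscr hF
  have hD1 : 1 ≤ D := by have := two_le_of_not_isSquare hD; omega
  set a := cyc D m₁
  set b := cyc D m₂
  have ha : a.IsReduced := isReduced_cyc hD hD4 m₁
  have hb : b.IsReduced := isReduced_cyc hD hD4 m₂
  obtain ⟨r₁, -, -, hc₁⟩ := cyc_eq hD hD4 m₁
  obtain ⟨r₂, -, -, hc₂⟩ := cyc_eq hD hD4 m₂
  have hsa : a.IsIdealShaped := by rw [show a = cyc D m₁ from rfl, hc₁]; exact isIdealShaped_iterate hD hD4 _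
  have hsb : b.IsIdealShaped := by rw [show b = cyc D m₂ from rfl, hc₂]; exact isIdealShaped_iterate hD hD4 _
  obtain ⟨d⟩ := exists_compData hsa hsb (isPrimitive_of_isFundDiscr hF hsa)
  obtain ⟨hzQ, hzQ0⟩ := compose_Q_le ha hb hsa hsb d
  set z := compose a b with hz
  have hadm : z.IsAdmissible := (isIdealShaped_compose hsa hsb d).isAdmissible
  have hK := gaussSteps_le hzQ
  have hg := compG_pos (y := b) hsa
  -- `κ = ∑ log |factorᵢ| + log g`
  have hfac : ∀ i, (gaussStep^[i] z).IsAdmissible ∧ 0 < (gaussStep^[i] z).Q := fun i => gaussIter_spec hD i hadm hzQ0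
  have hfac0 : ∀ i, gaussFactor (gaussStep^[i] z) ≠ 0 := fun i => by
    have := half_le_abs_gaussFactor hD (hfac i).1 (hfac i).2
    intro h; rw [h] at this; norm_num at this
  have hμ : Real.log |reduceMult z| = ∑ i ∈ range (gaussSteps z), Real.log |gaussFactor (gaussStep^[i] z)| := by
    rw [reduceMult, abs_gaussMult_eq_prod, Real.log_prod]
    intro i _; exact abs_ne_zero.mpr (hfac0 i)
  have hμpos : 0 < |reduceMult z| := by
    rw [reduceMult, abs_gaussMult_eq_prod]
    exact Finset.prod_pos fun i _ => abs_pos.mpr (hfac0 i)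
  have hkappa : kappaR D a b = (∑ i ∈ range (gaussSteps z), Real.log |gaussFactor (gaussStep^[i] z)|) +
      Real.log (compG a b) := by
    unfold kappaR; rw [← hz, Real.log_mul hμpos.ne' (by positivity), hμ]
  -- termwise errors
  have hterm : ∀ i, |(logFactorApprox D prec (gaussStep^[i] z) : ℝ) - Real.log (|gaussFactor (gaussStep^[i] z)|)| ≤
      (1 / 2) ^ prec := by
    intro i
    set y := gaussStep^[i] z
    unfold logFactorApprox gaussFactor
    by_cases hy : y.Q ^ 2 < D
    · simp [hy]
    · simp only [hy, if_false]
      have hQ' : (gaussRaw y).Q ≠ 0 := (isAdmissible_stepWith hD (hfac i).1 _).1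
      have h := abs_logQIApprox_sub_log_le hD hD1 (gaussRaw y).P hQ' prec
      exact h
  have hgterm : |(logNatApprox (compG a b).toNat prec : ℝ) - Real.log (compG a b)| ≤ (1 / 2) ^ prec := by
    have h1 : 1 ≤ (compG a b).toNat := by omega
    have h := abs_logNatApprox_sub_log_le h1 prec
    have hcast : (((compG a b).toNat : ℕ) : ℝ) = (compG a b : ℝ) := by
      have : (((compG a b).toNat : ℕ) : ℤ) = compG a b := Int.toNat_of_nonneg hg.le
      exact_mod_cast this
    rwa [hcast] at h
  rw [hkappa]
  unfold khatApprox
  rw [← hz]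
  -- peel off the rounding
  set S : ℚ := (∑ i ∈ range (gaussSteps z), logFactorApprox D prec (gaussStep^[i] z)) +
    logNatApprox (compG a b).toNat prec with hS
  have hround := abs_dyRound_sub_le prec S
  suffices hmain : |(S : ℝ) - ((∑ i ∈ range (gaussSteps z), Real.log |gaussFactor (gaussStep^[i] z)|) +
      Real.log (compG a b))| ≤ ((Ks D : ℝ) + 1) * (1 / 2) ^ prec by
    calc |(dyRound prec S : ℝ) - ((∑ i ∈ range (gaussSteps z), Real.log |gaussFactor (gaussStep^[i] z)|) +
          Real.log (compG a b))|
        ≤ |(dyRound prec S : ℝ) - S| + |(S : ℝ) - ((∑ i ∈ range (gaussSteps z),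
            Real.log |gaussFactor (gaussStep^[i] z)|) + Real.log (compG a b))| := abs_sub_le _ _ _
      _ ≤ (1 / 2) ^ prec + ((Ks D : ℝ) + 1) * (1 / 2) ^ prec := add_le_add hround hmain
      _ = ((Ks D + 2 : ℕ) : ℝ) * (1 / 2) ^ prec := by push_cast; ring
  rw [hS]
  push_cast
  have hsum : |∑ i ∈ range (gaussSteps z), ((logFactorApprox D prec (gaussStep^[i] z) : ℝ) -
      Real.log |gaussFactor (gaussStep^[i] z)|)| ≤ gaussSteps z * (1 / 2) ^ prec := by
    refine (Finset.abs_sum_le_sum_abs _ _).trans ?_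
    calc ∑ i ∈ range (gaussSteps z), |(logFactorApprox D prec (gaussStep^[i] z) : ℝ) -
          Real.log (|gaussFactor (gaussStep^[i] z)|)|
        ≤ ∑ _i ∈ range (gaussSteps z), (1 / 2 : ℝ) ^ prec := Finset.sum_le_sum fun i _ => hterm i
      _ = gaussSteps z * (1 / 2) ^ prec := by rw [Finset.sum_const, card_range, nsmul_eq_mul]
  have e : (∑ i ∈ range (gaussSteps z), (logFactorApprox D prec (gaussStep^[i] z) : ℝ)) +
      (logNatApprox (compG a b).toNat prec : ℝ) -
      ((∑ i ∈ range (gaussSteps z), Real.log |gaussFactor (gaussStep^[i] z)|) + Real.log (compG a b)) =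
      (∑ i ∈ range (gaussSteps z), ((logFactorApprox D prec (gaussStep^[i] z) : ℝ) -
        Real.log |gaussFactor (gaussStep^[i] z)|)) +
      ((logNatApprox (compG a b).toNat prec : ℝ) - Real.log (compG a b)) := by
    rw [Finset.sum_sub_distrib]; ring
  rw [e]
  refine (abs_add_le _ _).trans ?_
  have hK' : (gaussSteps z : ℝ) ≤ Ks D := by exact_mod_cast hK
  have h0 : (0 : ℝ) ≤ (1 / 2) ^ prec := by positivity
  calc |∑ i ∈ range (gaussSteps z), ((logFactorApprox D prec (gaussStep^[i] z) : ℝ) -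
          Real.log |gaussFactor (gaussStep^[i] z)|)| +
        |(logNatApprox (compG a b).toNat prec : ℝ) - Real.log (compG a b)|
      ≤ gaussSteps z * (1 / 2) ^ prec + (1 / 2) ^ prec := add_le_add hsum hgterm
    _ ≤ Ks D * (1 / 2) ^ prec + (1 / 2) ^ prec := by nlinarith
    _ = ((Ks D : ℝ) + 1) * (1 / 2) ^ prec := by ring

end Eval

/-! ### Integer formulas for the program

The program works with integers: the floors of the quadratic irrationalities it needs are integer
floor divisions by `⌊√D⌋ = Nat.sqrt D` (`⌊(P + √D)/Q⌋ = ⌊(P + ⌊√D⌋)/Q⌋` for `Q > 0`), and the unit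
ideal `x_p` is `(P₀, 2)` with `P₀ ∈ {⌊√D⌋, ⌊√D⌋ − 1}` of the parity of `D`. -/

section IntFormulas

/-- `⌊√D⌋ ≤ √D < ⌊√D⌋ + 1`. [folklore] -/
theorem nat_sqrt_le_sqrt (D : ℕ) : (Nat.sqrt D : ℝ) ≤ Real.sqrt D ∧ Real.sqrt D < Nat.sqrt D + 1 :=
  ⟨Real.nat_sqrt_le_real_sqrt, Real.real_sqrt_lt_nat_sqrt_succ⟩

/-- **`⌊(P + √D)/Q⌋ = (P + ⌊√D⌋) div Q`** for `Q > 0` (any `D`). [cite: JacobsonWilliams2008, §3.1 (q_i = ⌊(P_i + d)/Q_i⌋, d = ⌊√D⌋)] -/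
theorem floor_add_sqrt_div (D : ℕ) {P Q : ℤ} (hQ : 0 < Q) :
    ⌊((P : ℝ) + Real.sqrt D) / Q⌋ = (P + Nat.sqrt D) / Q := by
  obtain ⟨hs1, hs2⟩ := nat_sqrt_le_sqrt D
  set k := (P + Nat.sqrt D) / Q with hk
  have hQR : (0 : ℝ) < Q := by exact_mod_cast hQ
  have h1 : k * Q ≤ P + Nat.sqrt D := Int.ediv_mul_le _ hQ.ne'
  have h2 : P + Nat.sqrt D < (k + 1) * Q := by
    have := Int.lt_ediv_add_one_mul_self (P + Nat.sqrt D) hQ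
    linarith
  rw [Int.floor_eq_iff, le_div_iff₀ hQR, div_lt_iff₀ hQR]
  constructor
  · have : ((k * Q : ℤ) : ℝ) ≤ ((P + Nat.sqrt D : ℤ) : ℝ) := by exact_mod_cast h1
    push_cast at this; linarith
  · have : ((P + Nat.sqrt D : ℤ) : ℝ) + 1 ≤ (((k + 1) * Q : ℤ) : ℝ) := by exact_mod_cast h2
    push_cast at this; linarith

/-- **`⌊(√D − P)/Q⌋ = (⌊√D⌋ − P) div Q`** for `Q > 0` (the shift of `normalize`). [cite: JacobsonWilliams2008, §3.1] -/
theorem floor_sqrt_sub_div (D : ℕ) {P Q : ℤ} (hQ : 0 < Q) :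
    ⌊(Real.sqrt D - P) / Q⌋ = ((Nat.sqrt D : ℤ) - P) / Q := by
  have h := floor_add_sqrt_div D (P := -P) hQ
  push_cast at h
  rw [show Real.sqrt D - (P : ℝ) = -(P : ℝ) + Real.sqrt D by ring, h]
  congr 1; ring

/-- The quotient of the step as an integer division (as `InfraPrimitives.pq_eq_ediv` of
`InfrastructurePrimitives.lean`, proved independently here; a private copy). [cite: JacobsonWilliams2008, §3.1 (3.11)] -/
private theorem pq_eq_div {x : QuadIrr D} (hQ : 0 < x.Q) : x.pq = (x.P + Nat.sqrt D) / x.Q := by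
  unfold pq QuadIrr.val; exact floor_add_sqrt_div D hQ

/-- The `P`-coordinate of the reduced form of `𝒪`. [cite: Jozsa2003, §6.3 (𝒪 = ℤ + ((τ(D,2)+√D)/2)ℤ reduced)] -/
def unitP (D : ℕ) : ℤ := if Nat.sqrt D % 2 = D % 2 then (Nat.sqrt D : ℤ) else (Nat.sqrt D : ℤ) - 1

/-- **The unit ideal of the walk is `(P₀, 2)`**: `cyc D 0 = x_p = ⟨unitP D, 2⟩` — the unique reduced
quotient with `Q = 2` (`⌊√D⌋ − 1 ≤ P ≤ ⌊√D⌋`, `P ≡ D (mod 2)`). [cite: Jozsa2003, §6.3 Thm. 4] -/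
theorem cyc_zero_eq (hD : ¬ IsSquare D) (hF : IsFundDiscr D) : cyc D 0 = ⟨unitP D, 2⟩ := by
  have hD4 := mod_four_of_isFundDiscr hF
  rw [cyc_zero hD hD4]
  have hQ : (step^[periodLength D] (principalStart D)).Q = 2 := Q_iterate_periodLength hD hD4
  have hred : (step^[periodLength D] (principalStart D)).IsReduced := by
    have := isReduced_cyc hD hD4 0; rwa [cyc_zero hD hD4] at this
  have hsh : (step^[periodLength D] (principalStart D)).IsIdealShaped := isIdealShaped_iterate hD hD4 _
  generalize step^[periodLength D] (principalStart D) = y at hQ hred hsh ⊢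
  obtain ⟨hs1, hs2⟩ := nat_sqrt_le_sqrt D
  have hs1' : (Nat.sqrt D : ℝ) < Real.sqrt D := by
    rcases hs1.lt_or_eq with h | h
    · exact h
    · exfalso; apply hD; refine ⟨Nat.sqrt D, ?_⟩
      have : ((Nat.sqrt D : ℝ)) ^ 2 = D := by rw [h, Real.sq_sqrt (Nat.cast_nonneg _)]
      exact_mod_cast (by nlinarith [this] : (D : ℝ) = Nat.sqrt D * Nat.sqrt D)
  obtain ⟨-, hPle, -, -⟩ := hred.bounds
  have hlow : (Nat.sqrt D : ℤ) - 1 ≤ y.P := by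
    have h := hred.sqrt_lt_P_add_Q
    rw [hQ] at h; push_cast at h
    have : ((Nat.sqrt D : ℤ) : ℝ) - 1 < (y.P : ℝ) + 1 := by push_cast; linarith
    have : (Nat.sqrt D : ℤ) - 1 < y.P + 1 := by exact_mod_cast this
    omega
  -- parity: `4 ∣ P² − D`
  obtain ⟨c, hc⟩ := hsh.2.2
  rw [hQ] at hc
  have hpar : y.P % 2 = (D : ℤ) % 2 := by
    have h2 := two_dvd_sq_sub_self y.P
    omega
  have hsq : (Nat.sqrt D : ℤ) % 2 = ((Nat.sqrt D % 2 : ℕ) : ℤ) := by omega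
  have hDm : (D : ℤ) % 2 = ((D % 2 : ℕ) : ℤ) := by omega
  have hP : y.P = unitP D := by
    unfold unitP
    split_ifs with h
    · have : (Nat.sqrt D : ℤ) % 2 = (D : ℤ) % 2 := by rw [hsq, hDm, h]
      omega
    · have : (Nat.sqrt D : ℤ) % 2 ≠ (D : ℤ) % 2 := by
        rw [hsq, hDm]; exact_mod_cast h
      omega
  obtain ⟨P, Q⟩ := y
  simp only at hQ hP
  subst hQ; subst hP; rfl

/-! ### Guarded Gauss reduction (total and size-bounded on all inputs) -/

/-- The Gauss step keeps `Q ≥ 0`. [folklore] -/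
theorem gaussStep_Q_nonneg {x : QuadIrr D} (h : 0 ≤ x.Q) : 0 ≤ (gaussStep x).Q := by
  unfold gaussStep
  split_ifs with h1 h2
  · exact h
  · exact h2.le
  · show 0 ≤ -(gaussRaw x).Q
    linarith [not_lt.mp h2]

/-- **The guarded Gauss step** (identity when `Q < 0`). [folklore] -/
def gaussStepPos (x : QuadIrr D) : QuadIrr D := if 0 ≤ x.Q then gaussStep x else x

/-- On `Q ≥ 0` the guarded iteration is the Gauss iteration, and `Q` stays `≥ 0`. [folklore] -/
theorem iterate_gaussStepPos_eq {x : QuadIrr D} (h : 0 ≤ x.Q) :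
    ∀ n : ℕ, gaussStepPos^[n] x = gaussStep^[n] x ∧ 0 ≤ (gaussStep^[n] x).Q
  | 0 => ⟨rfl, h⟩
  | n + 1 => by
    obtain ⟨ih1, ih2⟩ := iterate_gaussStepPos_eq h n
    rw [Function.iterate_succ_apply', Function.iterate_succ_apply', ih1]
    exact ⟨by simp [gaussStepPos, ih2], gaussStep_Q_nonneg ih2⟩

/-- **The guarded normalisation** with the integer shift `(⌊√D⌋ − P) div Q` (identity when `Q ≤ 0`). [folklore] -/
def normalizePos (x : QuadIrr D) : QuadIrr D :=
  if 0 < x.Q then shiftP x (((Nat.sqrt D : ℤ) - x.P) / x.Q) else x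

/-- On `Q ≥ 0` the guarded normalisation is `normalize`. [folklore] -/
theorem normalizePos_eq {x : QuadIrr D} (h : 0 ≤ x.Q) : normalizePos x = QuadIrr.normalize x := by
  unfold normalizePos QuadIrr.normalize
  split_ifs with hQ
  · rw [floor_sqrt_sub_div D hQ]
  · have hQ0 : x.Q = 0 := by omega
    have : ⌊(Real.sqrt D - x.P) / (x.Q : ℝ)⌋ = 0 := by rw [hQ0]; simp
    rw [this]
    cases x; simp [shiftP]

/-- **The guarded reduction.** [folklore] -/
def reducePos (x : QuadIrr D) : QuadIrr D := normalizePos (gaussStepPos^[gaussSteps x] x)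

/-- On `Q ≥ 0` the guarded reduction is `reduce`. [folklore] -/
theorem reducePos_eq {x : QuadIrr D} (h : 0 ≤ x.Q) : reducePos x = reduce x := by
  unfold reducePos reduce
  obtain ⟨h1, h2⟩ := iterate_gaussStepPos_eq h (gaussSteps x)
  rw [h1, normalizePos_eq h2]

/-- Under the guards the composed quotient has `Q = 2A₁A₂ ≥ 0`. [folklore] -/
theorem compose_Q_nonneg_of_inBounds {a b : QuadIrr D} (ha : inBounds D a) (hb : inBounds D b) :
    0 ≤ (compose a b).Q := by
  obtain ⟨-, -, haQ, -⟩ := ha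
  obtain ⟨-, -, hbQ, -⟩ := hb
  have hfa : 0 ≤ fa a := by unfold fa; omega
  have hfb : 0 ≤ fa b := by unfold fa; omega
  have hg : 0 ≤ compG a b := by unfold compG; positivity
  show 0 ≤ 2 * (fa a / compG a b) * (fa b / compG a b)
  have h1 : 0 ≤ fa a / compG a b := Int.ediv_nonneg hfa hg
  have h2 : 0 ≤ fa b / compG a b := Int.ediv_nonneg hfb hg
  positivity

/-- **The guarded giant step via the guarded reduction** (what the program computes) equals
`starG`. [folklore] -/
theorem starG_eq_pos (D : ℕ) (a b : QuadIrr D) :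
    starG D a b = if inBounds D a ∧ inBounds D b ∧ inBounds D (reducePos (compose a b)) then
      reducePos (compose a b) else a := by
  unfold starG
  by_cases h : inBounds D a ∧ inBounds D b
  · rw [reducePos_eq (compose_Q_nonneg_of_inBounds h.1 h.2)]
  · rw [if_neg (fun h' => h ⟨h'.1, h'.2.1⟩), if_neg (fun h' => h ⟨h'.1, h'.2.1⟩)]

/-- **The guarded baby step as an integer formula**: for in-bounds input,
`stepG = (qQ − P, (D − (qQ − P)²)/Q)` with `q = (P + ⌊√D⌋) div Q`. [cite: JacobsonWilliams2008, §3.1 (3.11)] -/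
theorem stepG_eq_formula (D : ℕ) (a : QuadIrr D) :
    stepG D a = if inBounds D a ∧ inBounds D
      (⟨(a.P + Nat.sqrt D) / a.Q * a.Q - a.P, ((D : ℤ) - ((a.P + Nat.sqrt D) / a.Q * a.Q - a.P) ^ 2) / a.Q⟩ : QuadIrr D) then
      ⟨(a.P + Nat.sqrt D) / a.Q * a.Q - a.P, ((D : ℤ) - ((a.P + Nat.sqrt D) / a.Q * a.Q - a.P) ^ 2) / a.Q⟩ else a := by
  unfold stepG
  by_cases h : inBounds D a
  · have hQ : 0 < a.Q := by have := h.2.2.1; omega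
    have e : step a = ⟨(a.P + Nat.sqrt D) / a.Q * a.Q - a.P, ((D : ℤ) - ((a.P + Nat.sqrt D) / a.Q * a.Q - a.P) ^ 2) / a.Q⟩ := by
      rw [step, pq_eq_div hQ]
    rw [e]
  · rw [if_neg (fun h' => h h'.1), if_neg (fun h' => h h'.1)]

end IntFormulas



/-! ### The instance -/

/-- **The data Hallgren's walk computes with** on the principal cycle of discriminant `D` at
precision `prec`: unit ideal `x_p`, baby step `ρ = step`, giant step `reduce ∘ compose`, and the
fixed-point evaluators `ĝ`, `k̂` with the defect bound `Kq`. [cite: Jozsa2003, §9 (proof of Thm. 5)] -/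
def principalWalk (D prec : ℕ) : WalkData (QuadIrr D) where
  unit := ⟨unitP D, 2⟩
  rho := stepG D
  star := starG D
  ghat := ghatQ D prec
  khat := khatQ D prec
  K := Kq D

section Instance

variable (hD : ¬ IsSquare D) (hF : IsFundDiscr D)
include hD hF

/-- Gaps are `≤ 1 + size D` (`φ < 2√D`). [cite: Jozsa2003, §7 Prop. 31 (ln γ < ½ ln D + ln 2)] -/
theorem upos_succ_sub_le (m : ℤ) : upos D (m + 1) - upos D m ≤ 1 + Nat.size D := by
  have hD4 := mod_four_of_isFundDiscr hF
  have hD2 := two_le_of_not_isSquare hD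
  rw [upos_succ hD hD4, add_sub_cancel_left, step_cyc hD hD4]
  have hred := isReduced_cyc hD hD4 (m + 1)
  set y := cyc D (m + 1)
  have hQ1 : (1 : ℝ) ≤ y.Q := by exact_mod_cast hred.1
  have hv1 : 1 < y.val := hred.2.2.1
  have hP := hred.P_lt_sqrt
  have hsqrt : 0 < Real.sqrt D := Real.sqrt_pos.mpr (by exact_mod_cast (show 0 < D by omega))
  have hval : y.val ≤ 2 * Real.sqrt D := by
    have hnum : (0 : ℝ) < y.P + Real.sqrt D := by
      have := hred.Q_lt_P_add_sqrt; linarith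
    unfold QuadIrr.val
    rw [div_le_iff₀ (by linarith)]
    nlinarith
  have h1 : Real.log y.val ≤ Real.log (2 * Real.sqrt D) := Real.log_le_log (by linarith) hval
  have h2 : Real.log (2 * Real.sqrt D) = Real.log 2 + Real.log D / 2 := by
    rw [Real.log_mul (by norm_num) hsqrt.ne', Real.log_sqrt (by positivity)]
  have h3 : Real.log 2 ≤ 1 := by have := Real.log_two_lt_d9; linarith
  have h4 : Real.log D ≤ Nat.size D := log_le_size D
  have h5 : 0 ≤ Real.log D := Real.log_nonneg (by exact_mod_cast (show 1 ≤ D by omega))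
  linarith

/-- Two consecutive gaps exceed `log 2`. [cite: Jozsa2003, §7 Prop. 32 (δ(J, ρ²J) ≥ ln 2)] -/
theorem log_two_lt_upos_add_two_sub (m : ℤ) : Real.log 2 < upos D (m + 2) - upos D m := by
  have hD4 := mod_four_of_isFundDiscr hF
  obtain ⟨q, r, hr, hm⟩ := exists_eq_mul_add hD hD4 m
  have hc := (cyc_upos_of_eq hD hD4 hr hm).1
  rw [show m + 2 = m + 1 + 1 by ring, upos_succ hD hD4 (m + 1), upos_succ hD hD4 m, ← step_cyc hD hD4 m, hc,
    step_iterate, step_iterate, iterate_succ_principalStart, iterate_succ_principalStart]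
  have h := log_two_lt_gap_add_gap_succ hD hD4 (r + periodLength D)
  unfold gap at h
  linarith

/-- **The principal cycle of discriminant `D` with its fixed-point evaluators is a `GiantStepCycle`**
(so that the walk analysis of `InfrastructureNavigation.lean` applies to Hallgren's actual table):
`n = p`, `R = log ε`, `P = upos`, `lab = cyc`, `κ = log(|μ| g)` (clamped to `0` off the cycle),
`η = (Ks + 3)·2^{−prec} ≤ 1/8`, `G = 1 + size D`, `L = log 2`. [cite: Jozsa2003, §7 Props. 31–35, §9 Thm. 5] -/
def principalGSC (D prec : ℕ) (hD : ¬ IsSquare D) (hF : IsFundDiscr D) (hprec : etaR D prec ≤ 1 / 8) :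
    GiantStepCycle (QuadIrr D) where
  toWalkData := principalWalk D prec
  R := Real.log (fundUnit D)
  n := periodLength D
  P := upos D
  lab := cyc D
  kappa := kappa' D prec
  η := etaR D prec
  G := 1 + Nat.size D
  L := Real.log 2
  n_pos := periodLength_pos hD (mod_four_of_isFundDiscr hF)
  strictMono := upos_strictMono hD (mod_four_of_isFundDiscr hF)
  P_zero := upos_zero hD (mod_four_of_isFundDiscr hF)
  lab_zero := cyc_zero_eq hD hF
  periodic := fun m => upos_add_periodLength hD (mod_four_of_isFundDiscr hF) m
  lab_eq_iff := fun m m' => cyc_eq_cyc_iff hD (mod_four_of_isFundDiscr hF) m m'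
  rho_lab := fun m => by
    have hD4 := mod_four_of_isFundDiscr hF
    show stepG D (cyc D m) = cyc D (m + 1)
    rw [stepG_of_isReduced (isReduced_cyc hD hD4 m) (by rw [step_cyc hD hD4]; exact isReduced_cyc hD hD4 (m + 1))]
    exact step_cyc hD hD4 m
  star_lab := fun m₁ m₂ => by
    obtain ⟨m, hc, hu⟩ := exists_cyc_giant hD hF m₁ m₂
    have hD4 := mod_four_of_isFundDiscr hF
    refine ⟨m, ?_, ?_⟩
    · show cyc D m = starG D (cyc D m₁) (cyc D m₂)
      rw [starG_of_isReduced (isReduced_cyc hD hD4 m₁) (isReduced_cyc hD hD4 m₂)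
        (by rw [← hc]; exact isReduced_cyc hD hD4 m)]
      exact hc
    · have hcyc : IsCyc D (cyc D m₁) ∧ IsCyc D (cyc D m₂) := ⟨⟨m₁, rfl⟩, ⟨m₂, rfl⟩⟩
      show upos D m = upos D m₁ + upos D m₂ + kappa' D prec (cyc D m₁) (cyc D m₂)
      rw [kappa', if_pos hcyc]
      exact hu
  abs_kappa_le := fun a b => by
    show |kappa' D prec a b| ≤ ((Kq D : ℚ) : ℝ)
    have hK0 : (0 : ℚ) ≤ Kq D := by unfold Kq; exact_mod_cast Nat.zero_le _
    unfold kappa'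
    split_ifs with h
    · obtain ⟨⟨m₁, rfl⟩, ⟨m₂, rfl⟩⟩ := h
      exact abs_kappaR_le hD hF m₁ m₂
    · have := abs_clampQ_le hK0 (if inBounds D a ∧ inBounds D b then khatApprox D prec a b else 0)
      unfold khatQ
      exact_mod_cast this
  ghat_spec := fun m => by
    show |(ghatQ D prec (cyc D m) : ℝ) - (upos D (m + 1) - upos D m)| ≤ etaR D prec
    refine (abs_ghatQ_sub_le hD hF prec m).trans ?_
    unfold etaR
    have h0 : (0 : ℝ) ≤ (1 / 2) ^ prec := by positivity
    have h1 : (2 : ℝ) ≤ ((Ks D + 3 : ℕ) : ℝ) := by exact_mod_cast (show 2 ≤ Ks D + 3 by omega)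
    nlinarith
  khat_spec := fun a b => by
    show |(khatQ D prec a b : ℝ) - kappa' D prec a b| ≤ etaR D prec
    have hD4 := mod_four_of_isFundDiscr hF
    have h0 : (0 : ℝ) ≤ (1 / 2) ^ prec := by positivity
    unfold kappa'
    split_ifs with h
    · obtain ⟨⟨m₁, rfl⟩, ⟨m₂, rfl⟩⟩ := h
      have hb : inBounds D (cyc D m₁) ∧ inBounds D (cyc D m₂) :=
        ⟨inBounds_of_isReduced (isReduced_cyc hD hD4 m₁), inBounds_of_isReduced (isReduced_cyc hD hD4 m₂)⟩
      unfold khatQ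
      rw [if_pos hb]
      refine (abs_clampQ_sub_le (abs_kappaR_le hD hF m₁ m₂)).trans ?_
      refine (abs_khatApprox_sub_kappaR_le hD hF prec m₁ m₂).trans ?_
      unfold etaR; push_cast; nlinarith
    · rw [sub_self, abs_zero]; unfold etaR; positivity
  η_nonneg := by unfold etaR; positivity
  η_le := hprec
  gap_le := fun m => by
    show upos D (m + 1) - upos D m ≤ 1 + (Nat.size D : ℝ)
    exact upos_succ_sub_le hD hF m
  two_gap := fun m => (log_two_lt_upos_add_two_sub hD hF m).le
  L_gt := by
    show 2 * etaR D prec < Real.log 2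
    have := Real.log_two_gt_d9
    linarith

/-- The walk data of the instance is `principalWalk` (what the program computes). [folklore] -/
theorem principalGSC_toWalkData (prec : ℕ) (hprec : etaR D prec ≤ 1 / 8) :
    (principalGSC D prec hD hF hprec).toWalkData = principalWalk D prec := rfl

/-- The circumference of the instance is the regulator `log ε`. [folklore] -/
theorem principalGSC_R (prec : ℕ) (hprec : etaR D prec ≤ 1 / 8) :
    (principalGSC D prec hD hF hprec).R = Real.log (fundUnit D) := rfl

omit hD hF in
/-- A sufficient precision: `etaR D prec ≤ 1/8` as soon as `2^prec ≥ 8 (Ks D + 3)`, e.g.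
`prec = size (Ks D + 3) + 3`. [folklore] -/
theorem etaR_le (prec : ℕ) (h : Nat.size (Ks D + 3) + 3 ≤ prec) : etaR D prec ≤ 1 / 8 := by
  unfold etaR
  have h1 : ((Ks D + 3 : ℕ) : ℝ) < 2 ^ Nat.size (Ks D + 3) := by exact_mod_cast Nat.lt_size_self _
  have h2 : (1 / 2 : ℝ) ^ prec ≤ (1 / 2) ^ (Nat.size (Ks D + 3) + 3) :=
    pow_le_pow_of_le_one (by norm_num) (by norm_num) h
  have h3 : (1 / 2 : ℝ) ^ (Nat.size (Ks D + 3) + 3) = 1 / (2 ^ Nat.size (Ks D + 3) * 8) := by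
    rw [pow_add, one_div_pow, one_div_pow]; norm_num; ring
  have hpos : (0 : ℝ) < 2 ^ Nat.size (Ks D + 3) := by positivity
  calc ((Ks D + 3 : ℕ) : ℝ) * (1 / 2) ^ prec ≤ ((Ks D + 3 : ℕ) : ℝ) * (1 / 2) ^ (Nat.size (Ks D + 3) + 3) :=
        mul_le_mul_of_nonneg_left h2 (by positivity)
    _ = ((Ks D + 3 : ℕ) : ℝ) / 2 ^ Nat.size (Ks D + 3) * (1 / 8) := by rw [h3]; field_simp
    _ ≤ 1 * (1 / 8) := by
        apply mul_le_mul_of_nonneg_right _ (by norm_num)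
        rw [div_le_one hpos]; exact h1.le
    _ = 1 / 8 := one_mul _

end Instance


/-! ### The walk on integer pairs (transport for the program) -/

/-- Integer pairs `(P, Q)`. [folklore] -/
abbrev ZZ : Type := ℤ × ℤ

/-- Forgetting the discriminant. [folklore] -/
def toZ (x : QuadIrr D) : ZZ := (x.P, x.Q)

/-- Remembering the discriminant. [folklore] -/
def ofZ (z : ZZ) : QuadIrr D := ⟨z.1, z.2⟩

/-- `toZ ∘ ofZ = id`. [folklore] -/
@[simp] theorem toZ_ofZ (z : ZZ) : toZ (ofZ (D := D) z) = z := rfl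
/-- `ofZ ∘ toZ = id`. [folklore] -/
@[simp] theorem ofZ_toZ (x : QuadIrr D) : ofZ (toZ x) = x := by cases x; rfl

/-- **The walk data on integer pairs**: `principalWalk` transported along `toZ`/`ofZ` (this is the
form whose polynomial-time computability is proved). [cite: Jozsa2003, §9 Thm. 5] -/
def walkZ (D prec : ℕ) : WalkData ZZ where
  unit := (unitP D, 2)
  rho := fun z => toZ (stepG D (ofZ z))
  star := fun z w => toZ (starG D (ofZ z) (ofZ w))
  ghat := fun z => ghatQ D prec (ofZ z)
  khat := fun z w => khatQ D prec (ofZ z) (ofZ w)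
  K := Kq D

namespace WalkMap

open WalkData

variable {ι ι' : Type*} (W : WalkData ι) (W' : WalkData ι') (φ : ι → ι')
  (hu : φ W.unit = W'.unit) (hr : ∀ a, φ (W.rho a) = W'.rho (φ a))
  (hs : ∀ a b, φ (W.star a b) = W'.star (φ a) (φ b)) (hg : ∀ a, W.ghat a = W'.ghat (φ a))
  (hk : ∀ a b, W.khat a b = W'.khat (φ a) (φ b)) (hK : W.K = W'.K)

/-- Transport of states. [folklore] -/
def mapSt (s : ι × ℚ) : ι' × ℚ := (φ s.1, s.2)

include hr hg in
/-- Naturality of the walk under a map of walk data (`map_babyStep`). [folklore] -/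
theorem map_babyStep (s : ι × ℚ) : mapSt φ (W.babyStep s) = W'.babyStep (mapSt φ s) := by
  simp [mapSt, babyStep, hr, hg]

include hs hk in
/-- Naturality of the walk under a map of walk data (`map_giantStep`). [folklore] -/
theorem map_giantStep (s t : ι × ℚ) : mapSt φ (W.giantStep s t) = W'.giantStep (mapSt φ s) (mapSt φ t) := by
  simp [mapSt, giantStep, hs, hk]

include hr hg hK in
/-- Naturality of the walk under a map of walk data (`map_startStep`). [folklore] -/
theorem map_startStep (s : ι × ℚ) : mapSt φ (W.startStep s) = W'.startStep (mapSt φ s) := by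
  unfold startStep
  rw [← hK]
  show mapSt φ (if s.2 < 2 * W.K + 1 then W.babyStep s else s) = if s.2 < 2 * W.K + 1 then _ else _
  split_ifs <;> simp [map_babyStep W W' φ hr hg]

include hu hr hg hK in
/-- Naturality of the walk under a map of walk data (`map_start`). [folklore] -/
theorem map_start (s₀ : ℕ) : mapSt φ (W.start s₀) = W'.start s₀ := by
  unfold start
  induction s₀ with
  | zero => simp [mapSt, hu]
  | succ n ih => rw [Function.iterate_succ_apply', Function.iterate_succ_apply', map_startStep W W' φ hr hg hK, ih]

include hu hr hs hg hk hK in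
/-- Naturality of the walk under a map of walk data (`map_dbl`). [folklore] -/
theorem map_dbl (s₀ : ℕ) : ∀ k, mapSt φ (W.dbl s₀ k) = W'.dbl s₀ k
  | 0 => by simp [dbl, map_start W W' φ hu hr hg hK]
  | k + 1 => by rw [dbl, dbl, map_giantStep W W' φ hs hk, map_dbl s₀ k]

include hu hr hs hg hk hK in
/-- Naturality of the walk under a map of walk data (`map_descStep`). [folklore] -/
theorem map_descStep (x : ℚ) (s₀ : ℕ) (J : ι × ℚ) (k : ℕ) :
    mapSt φ (W.descStep x s₀ J k) = W'.descStep x s₀ (mapSt φ J) k := by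
  unfold descStep
  rw [← map_dbl W W' φ hu hr hs hg hk hK s₀ k, ← map_giantStep W W' φ hs hk]
  show mapSt φ (if (W.giantStep J (W.dbl s₀ k)).2 ≤ x then _ else _) = if (W.giantStep J (W.dbl s₀ k)).2 ≤ x then _ else _
  split_ifs <;> rfl

include hu hr hs hg hk hK in
/-- Naturality of the walk under a map of walk data (`map_foldl_descStep`). [folklore] -/
theorem map_foldl_descStep (x : ℚ) (s₀ : ℕ) (l : List ℕ) (J : ι × ℚ) :
    mapSt φ (l.foldl (W.descStep x s₀) J) = l.foldl (W'.descStep x s₀) (mapSt φ J) := by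
  induction l generalizing J with
  | nil => rfl
  | cons k l ih => rw [List.foldl_cons, List.foldl_cons, ih, map_descStep W W' φ hu hr hs hg hk hK]

include hu hr hs hg hk hK in
/-- Naturality of the walk under a map of walk data (`map_descent`). [folklore] -/
theorem map_descent (x : ℚ) (s₀ T : ℕ) : mapSt φ (W.descent x s₀ T) = W'.descent x s₀ T := by
  unfold descent descentFrom
  rw [map_foldl_descStep W W' φ hu hr hs hg hk hK]
  simp [mapSt, hu]

include hr hg in
/-- Naturality of the walk under a map of walk data (`map_finStep`). [folklore] -/
theorem map_finStep (x : ℚ) (J : ι × ℚ) : mapSt φ (W.finStep x J) = W'.finStep x (mapSt φ J) := by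
  unfold finStep
  rw [← map_babyStep W W' φ hr hg]
  show mapSt φ (if (W.babyStep J).2 ≤ x then _ else _) = if (W.babyStep J).2 ≤ x then _ else _
  split_ifs <;> rfl

include hu hr hs hg hk hK in
/-- **The walk is natural** under maps of the data: `φ(final) = final'`. [folklore] -/
theorem map_final (x : ℚ) (s₀ T B : ℕ) : mapSt φ (W.final x s₀ T B) = W'.final x s₀ T B := by
  unfold final
  induction B with
  | zero => simp [map_descent W W' φ hu hr hs hg hk hK]
  | succ n ih => rw [Function.iterate_succ_apply', Function.iterate_succ_apply', map_finStep W W' φ hr hg, ih]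

include hu hr hs hg hk hK in
/-- **The table is natural** under maps of the data. [folklore] -/
theorem map_table (N s₀ T B : ℕ) (v : ℤ) :
    Prod.map φ id (W.table N s₀ T B v) = W'.table N s₀ T B v := by
  unfold table
  rw [← map_final W W' φ hu hr hs hg hk hK]
  rfl

end WalkMap

/-- **Hallgren's table is the integer-pair walk read back**:
`(principalWalk).table = (ofZ × id) ∘ (walkZ).table`. [cite: Jozsa2003, §9 Thm. 5] -/
theorem principalWalk_table_eq (D prec N s₀ T B : ℕ) (v : ℤ) :
    Prod.map toZ id ((principalWalk D prec).table N s₀ T B v) = (walkZ D prec).table N s₀ T B v :=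
  WalkMap.map_table (principalWalk D prec) (walkZ D prec) toZ rfl (fun a => by simp [principalWalk, walkZ])
    (fun a b => by simp [principalWalk, walkZ]) (fun a => by simp [principalWalk, walkZ])
    (fun a b => by simp [principalWalk, walkZ]) rfl N s₀ T B v

end Hallgren2007

end Literature.Computability.Cryptography

end
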